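import Mathlib.GroupTheory.Transfer
import Mathlib.GroupTheory.Abelianization.Defs
import HarnessLib

/-!
# The transfer of an element acting trivially on the cosets: the product of its conjugates over a
# transversal

Topic `Literature/GroupTheory/CombinatorialGroupTheory`; theorems only.  For a subgroup `H ≤ G` of
finite index, a left transversal `S` with representatives `s_q` (`q ∈ G/H`), and an element `g ∈ G`
fixing every coset (equivalently: all conjugates `s⁻¹ g s` lie in `H`, e.g. `g` in a normal subgroup
of `G` contained in `H`), the transfer `V : G → H^{ab}` (composed with `ϕ : H → A`) is

  `V(g) = ∏_{q ∈ G/H} ϕ(s_q⁻¹ · g · s_q)`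

— the classical formula (K. S. Brown, *Cohomology of Groups*, III §9, p. 80 ff.; B. Huppert,
*Endliche Gruppen I*, IV.1) specialised to an element with all cycles on `G/H` of length one.  As a
consequence, if moreover `g` lies in the commutator subgroup `[G, G]`, then the product
`∏_q s_q⁻¹ g s_q` (in any order) lies in `[H, H]` (`prod_conj_mem_commutator`) — the form in which
the transfer enters the computation of the degree of a finite covering of surface groups
(`SurfaceGroupCoveringDegree*.lean`).  Over Mathlib's `MonoidHom.transfer`, `Subgroup.leftTransversals.diff`.
-/

namespace Literature.GroupTheory.CombinatorialGroupTheory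

open Subgroup Subgroup.leftTransversals MulAction

open scoped Pointwise

universe u v

variable {G : Type u} [Group G] {H : Subgroup G} {A : Type v} [CommGroup A]

/-- For `g` fixing every left coset of `H`, the conjugate `s⁻¹ g s` by any element lies in `H`.
[cite: Brown1982CohomologyGroups, III §9] -/
theorem inv_mul_mul_mem_of_forall_smul_eq {g : G} (hg : ∀ q : G ⧸ H, g • q = q) (s : G) :
    s⁻¹ * g * s ∈ H := by
  have h := hg (s : G ⧸ H)
  rw [MulAction.Quotient.smul_coe, QuotientGroup.eq] at h
  -- `h : (g s)⁻¹ s = s⁻¹ g⁻¹ s ∈ H`; invert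
  have h' := H.inv_mem h
  simpa only [smul_eq_mul, mul_inv_rev, inv_inv, mul_assoc] using h'

/-- **Transfer of an element acting trivially on `G/H`.**  If `g • q = q` for every coset `q` (e.g.
`g` lies in a normal subgroup of `G` contained in `H`), then for every left transversal `S` with
coset representatives `s_q = S.2.leftQuotientEquiv q`,
`transfer ϕ g = ∏_q ϕ ⟨s_q⁻¹ g s_q⟩`. [cite: Brown1982CohomologyGroups, III §9] -/
theorem transfer_eq_prod_conj [H.FiniteIndex] (ϕ : H →* A) (S : H.LeftTransversal) {g : G}
    (hg : ∀ q : G ⧸ H, g • q = q) :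
    letI := H.fintypeQuotientOfFiniteIndex
    MonoidHom.transfer ϕ g =
      ∏ q : G ⧸ H, ϕ ⟨(S.2.leftQuotientEquiv q : G)⁻¹ * g * S.2.leftQuotientEquiv q,
        inv_mul_mul_mem_of_forall_smul_eq hg _⟩ := by
  letI := H.fintypeQuotientOfFiniteIndex
  rw [MonoidHom.transfer_def ϕ S g]
  unfold diff
  refine Finset.prod_congr rfl fun q _ => ?_
  congr 1
  apply Subtype.ext
  simp only
  rw [smul_apply_eq_smul_apply_inv_smul, smul_eq_mul, mul_assoc]
  have hq : g⁻¹ • q = q :=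
    calc g⁻¹ • q = g⁻¹ • g • q := by rw [hg q]
      _ = q := inv_smul_smul g q
  rw [hq]

/-- **The product of the conjugates of a commutator element over a transversal is a commutator in the
subgroup.**  If `g ∈ [G, G]` fixes every coset of `H` (finite index), then for any left transversal with
representatives `s_q`, the product `∏_q s_q⁻¹ g s_q` — taken in `H`, over the list of cosets in any
enumeration `l` of `G/H` without repetition covering all cosets — lies in the commutator subgroup
`[H, H]`: its image in `H^{ab}` is the transfer of `g`, and the transfer, a homomorphism to an abelian
group, kills `[G, G]`. [cite: Brown1982CohomologyGroups, III §9] -/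
theorem prod_conj_mem_commutator [H.FiniteIndex] (S : H.LeftTransversal) {g : G}
    (hg : ∀ q : G ⧸ H, g • q = q) (hcomm : g ∈ commutator G) :
    letI := H.fintypeQuotientOfFiniteIndex
    ((Finset.univ : Finset (G ⧸ H)).toList.map fun q =>
        (⟨(S.2.leftQuotientEquiv q : G)⁻¹ * g * S.2.leftQuotientEquiv q,
          inv_mul_mul_mem_of_forall_smul_eq hg _⟩ : H)).prod ∈ commutator H := by
  letI := H.fintypeQuotientOfFiniteIndex
  rw [← Abelianization.ker_of, MonoidHom.mem_ker, map_list_prod, List.map_map]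
  change ((Finset.univ : Finset (G ⧸ H)).toList.map (fun q => Abelianization.of _)).prod = 1
  rw [Finset.prod_map_toList, ← transfer_eq_prod_conj Abelianization.of S hg]
  exact (MonoidHom.mem_ker).mp (Abelianization.commutator_subset_ker _ hcomm)

end Literature.GroupTheory.CombinatorialGroupTheory
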